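import Mathlib
import Literature.NumberTheory.LFunctions.Zhang2022.SkeletonPartOne
import Literature.NumberTheory.LFunctions.Zhang2022.Section4PartialIntegration
import Literature.NumberTheory.LFunctions.Zhang2022.Section3Lemma36
import HarnessLib

/-!
# Zhang (2022) §4, Lemma 4.1 — the skeleton node `Skeleton.Lemma41` DISCHARGED:
# `|F(s,ψ)| + |G(s,ψ)| ≤ 2𝓛⁷⁹` for `ψ ∈ Ψ₁`, `s ∈ Ω₁`

Topic `Literature/NumberTheory/LFunctions/Zhang2022` (Landau–Siegel audit tree; verdict-neutral;
D-0069 campaign node **Z22:Lem4.1** (+ its proof block **Z22:Lem4.1.pf**), locator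
[Z22 p.16–17, §4 Lemma 4.1, tex L899–L923]).
Y. Zhang, *Discrete mean estimates and the Landau–Siegel zero*, arXiv:2211.02515v1 (2022)
[Zhang2022LandauSiegel] — **an unrefereed manuscript under adjudication**. The printed claim:

> **Lemma 4.1.** Let `Ω₁ = {s : 1/2 − (100𝓛)⁻¹log 𝓛 < σ < 1 + (100𝓛)⁻¹log 𝓛, |t − 2πt₀| < 𝓛₁ + 5}`.
> If `s ∈ Ω₁` [and `ψ ∈ Ψ₁`], then `|F(s,ψ)| + |G(s,ψ)| ≪ 𝓛⁷⁹`.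
> *Proof.* By the Stieltjes integral we may write `F(s,ψ)²⁰ = 1 + ∫₁^{D⁸⁰} x^{s₀−s} d{X₁(x,ψ)}`.
> For `s ∈ Ω₁` and `1 ≤ x ≤ D⁸⁰` we have `|x^{s₀−s}| ≪ 𝓛`, `|d/dx (x^{s₀−s})| ≪ x⁻¹𝓛⁴⁰⁶`. Hence,
> by partial integration, `|F(s,ψ)|²⁰ ≪ 1 + 𝓛⁴⁰⁶(|X₁(D⁸⁰,ψ)| + ∫₁^{D⁸⁰} |X₁(x,ψ)| x⁻¹dx)`. For
> `G(s,ψ)` an entirely analogous bound is valid. The result now follows by (3.4). □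

This file proves `Skeleton.lemma41_holds : Skeleton.Lemma41` — the node EXACTLY as typed in
`SkeletonPartOne` (`∃ C, ForAllLarge (∀ ψ ∈ Ψ₁, ∀ s ∈ Ω₁, ‖F(s,ψ)‖ + ‖G(s,ψ)‖ ≤ C𝓛⁷⁹)`), with
`C = 2` and threshold `D ≥ ⌈e³²⌉` (`𝓛 ≥ 32`) — by assembling tree theorems only:

* the algebra `F(s,ψ)²⁰ = Σ_{n≤D⁸⁰} ν₂₀(n)ψ(n)n^{−s}` (§3 p. 7: "By (3.1) we may write …"): here
  `Lemma41Holds.sum_pow_eq_sum_convPow` — the `k`-th power of a twisted Dirichlet polynomial with coefficients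
  supported on `n ≤ N` is the twisted Dirichlet polynomial of the `k`-fold convolution power
  (`Skeleton.convPow`), supported on `n ≤ Nᵏ`; with `Skeleton.nu20 = convPow (trunc D⁴ ν) 20` this is
  literally the skeleton's `ν₂₀`, and `X₁` of `SkeletonObjects` is the partial-sum function
  `Lemma41.Xsum` of `Section4PartialIntegration` for the normalised coefficients `ν₂₀(n)ψ(n)n^{−s₀}`;
* the partial integration and the two pointwise bounds on `Ω₁`: the tree's
  `Lemma41.norm_F20_le` (`Section4PartialIntegration`), giving
  `|F|²⁰ ≤ 𝓛^{4/5}|X₁(D⁸⁰)| + 𝓛⁴⁰⁶∫₁^{D⁸⁰}|X₁|dx/x ≤ 𝓛⁴⁰⁶ · 𝓛¹¹⁷¹ = 𝓛¹⁵⁷⁷` by (3.4) = `Skeleton.Ineq34`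
  (part of the DEFINITION of `ψ ∈ Ψ₁ = Skeleton.PsiOne`), then `|F| ≤ 𝓛^{1577/20} ≤ 𝓛⁷⁹`
  (`Lemma41.norm_le_rpow_of_pow_le`, `Lemma41.exponent_lemma41`: `1577/20 = 78.85 < 79`); the same
  for `G` with `υ₂₀`, `X₂`;
* interval-integrability of the step functions `|Xⱼ(x,ψ)|/x` (to split the integral in (3.4)):
  the tree's `Lemma36.intervalIntegrable_natFloor_div` (`Section3Lemma36`).

No Assumption (A) (§4 precedes the blanket assumption of p. 28), no named fact, no new definition
(theorem-only file). WHAT THIS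
IS NOT: any statement about Theorems 1–2 of the manuscript or about Landau–Siegel zeros; Lemma 4.1 is
an elementary consequence of the definition of `Ψ₁`, and discharging it says nothing about the
cell's verdict on (8.24).

## References

* Y. Zhang, arXiv:2211.02515v1 (2022), §3 p. 7 ((3.1), `F`, `G`, `ν₂₀`, `X₁`, `X₂`, (3.4)), §4
  Lemma 4.1 pp. 16–17. [cite: Zhang2022LandauSiegel, §4 Lemma 4.1]
-/

noncomputable section

open Complex Real Finset MeasureTheory

namespace Literature.NumberTheory.LFunctions.Zhang2022

namespace Lemma41Holds

open Skeleton

/-! ### Twisted Dirichlet polynomials: products and powers (§3 p. 7, "By (3.1) we may write …") -/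

variable {p : ℕ} (ψ : DirichletCharacter ℂ p)

/-! All statements below are about the twisted Dirichlet polynomials
`Σ_{1 ≤ n ≤ M} a(n)ψ(n)n^{−s}` (the shape of `F(s,ψ)`, `G(s,ψ)`, `F(s,ψ)²⁰`, … of §3 p. 7), written
out in full (no auxiliary definition). -/

/-- **Product of two twisted Dirichlet polynomials**: if `a` is supported on `n ≤ A` and `b` on
`n ≤ B`, then `(Σ_{n≤A} a(n)ψ(n)n^{−s})(Σ_{n≤B} b(n)ψ(n)n^{−s}) = Σ_{n≤AB} (a∗b)(n)ψ(n)n^{−s}`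
(`ψ` completely multiplicative) — the step behind "`F(s,ψ)G(s,ψ) − 1 = Σ_{D⁴<n≤D⁸} ς(n)ψ(n)n^{−s}`"
(§4 Lemma 4.2, proof) and "`F(s,ψ)²⁰ = Σ_{n≤D⁸⁰} ν₂₀(n)ψ(n)n^{−s}`" (§3 p. 7).
[cite: Zhang2022LandauSiegel, §3 p. 7] -/
theorem sum_mul_sum_eq_sum_convolution (a b : ℕ → ℂ) {A B : ℕ} (ha : ∀ n, A < n → a n = 0)
    (hb : ∀ n, B < n → b n = 0) (s : ℂ) :
    (∑ n ∈ Icc 1 A, a n * ψ (n : ZMod p) * (n : ℂ) ^ (-s)) *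
        (∑ n ∈ Icc 1 B, b n * ψ (n : ZMod p) * (n : ℂ) ^ (-s)) =
      ∑ n ∈ Icc 1 (A * B), LSeries.convolution a b n * ψ (n : ZMod p) * (n : ℂ) ^ (-s) := by
  classical
  set T : ℕ × ℕ → ℂ := fun q =>
    a q.1 * b q.2 * ψ ((q.1 * q.2 : ℕ) : ZMod p) * ((q.1 * q.2 : ℕ) : ℂ) ^ (-s) with hT
  have hlhs : (∑ n ∈ Icc 1 A, a n * ψ (n : ZMod p) * (n : ℂ) ^ (-s)) *
        (∑ n ∈ Icc 1 B, b n * ψ (n : ZMod p) * (n : ℂ) ^ (-s)) = ∑ q ∈ Icc 1 A ×ˢ Icc 1 B, T q := by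
    rw [Finset.sum_mul_sum, ← Finset.sum_product']
    refine Finset.sum_congr rfl fun q _ => ?_
    simp only [hT, Nat.cast_mul, map_mul, Complex.natCast_mul_natCast_cpow]
    ring
  have hrhs : ∑ n ∈ Icc 1 (A * B), LSeries.convolution a b n * ψ (n : ZMod p) * (n : ℂ) ^ (-s) =
      ∑ q ∈ (Icc 1 (A * B)).biUnion Nat.divisorsAntidiagonal, T q := by
    rw [Finset.sum_biUnion]
    · refine Finset.sum_congr rfl fun k _ => ?_
      rw [LSeries.convolution_def, Finset.sum_mul, Finset.sum_mul]
      refine Finset.sum_congr rfl fun q hq => ?_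
      have hqk : q.1 * q.2 = k := (Nat.mem_divisorsAntidiagonal.mp hq).1
      simp only [hT, hqk]
    · intro k₁ _ k₂ _ hne
      exact Finset.disjoint_left.mpr fun q h1 h2 =>
        hne ((Nat.mem_divisorsAntidiagonal.mp h1).1.symm.trans (Nat.mem_divisorsAntidiagonal.mp h2).1)
  rw [hlhs, hrhs]
  refine Finset.sum_subset ?_ ?_
  · intro q hq
    obtain ⟨h1, h2⟩ := Finset.mem_product.mp hq
    obtain ⟨h1a, h1b⟩ := Finset.mem_Icc.mp h1
    obtain ⟨h2a, h2b⟩ := Finset.mem_Icc.mp h2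
    refine Finset.mem_biUnion.mpr ⟨q.1 * q.2, Finset.mem_Icc.mpr ⟨?_, Nat.mul_le_mul h1b h2b⟩, ?_⟩
    · exact Nat.one_le_iff_ne_zero.mpr (Nat.mul_ne_zero (by omega) (by omega))
    · exact Nat.mem_divisorsAntidiagonal.mpr ⟨rfl, Nat.mul_ne_zero (by omega) (by omega)⟩
  · intro q hq hq'
    obtain ⟨k, _, hqk⟩ := Finset.mem_biUnion.mp hq
    obtain ⟨hk1, hk2⟩ := Nat.mem_divisorsAntidiagonal.mp hqk
    have hq1 : q.1 ≠ 0 := fun h => hk2 (by rw [← hk1, h, zero_mul])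
    have hq2 : q.2 ≠ 0 := fun h => hk2 (by rw [← hk1, h, mul_zero])
    rw [Finset.mem_product, Finset.mem_Icc, Finset.mem_Icc, not_and_or] at hq'
    rcases hq' with h | h
    · have hA : A < q.1 := by omega
      simp only [hT, ha _ hA, zero_mul]
    · have hB : B < q.2 := by omega
      simp only [hT, hb _ hB, mul_zero, zero_mul]

/-- The `k`-fold convolution power of a sequence supported on `n ≤ N` is supported on `n ≤ Nᵏ`
(§3 p. 7: `ν₂₀`, `υ₂₀` are supported on `n ≤ D⁸⁰` — "`F(s,ψ)²⁰ = Σ_{n≤D⁸⁰} ν₂₀(n)ψ(n)n^{−s}`").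
[cite: Zhang2022LandauSiegel, §3 p. 7] -/
theorem convPow_eq_zero_of_lt (a : ℕ → ℂ) {N : ℕ} (ha : ∀ n, N < n → a n = 0) :
    ∀ k n : ℕ, N ^ k < n → convPow a k n = 0 := by
  intro k
  induction k with
  | zero =>
    intro n hn
    rw [pow_zero] at hn
    simp only [convPow]
    rw [if_neg]
    omega
  | succ k ih =>
    intro n hn
    simp only [convPow]
    rw [LSeries.convolution_def]
    refine Finset.sum_eq_zero fun q hq => ?_
    have hqn : q.1 * q.2 = n := (Nat.mem_divisorsAntidiagonal.mp hq).1
    by_cases h1 : N < q.1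
    · rw [ha _ h1, zero_mul]
    · have h2 : N ^ k < q.2 := by
        push Not at h1
        by_contra h2
        push Not at h2
        have hle : q.1 * q.2 ≤ N * N ^ k := Nat.mul_le_mul h1 h2
        rw [pow_succ'] at hn
        omega
      rw [ih _ h2, mul_zero]

/-- **Powers of a twisted Dirichlet polynomial** ("By (3.1) we may write
`F(s,ψ)²⁰ = Σ_{n≤D⁸⁰} ν₂₀(n)ψ(n)n^{−s}`", §3 p. 7): for `a` supported on `n ≤ N`,
`(Σ_{n≤N} a(n)ψ(n)n^{−s})ᵏ = Σ_{n≤Nᵏ} a^{∗k}(n)ψ(n)n^{−s}` with `a^{∗k} = Skeleton.convPow a k`.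
[cite: Zhang2022LandauSiegel, §3 p. 7] -/
theorem sum_pow_eq_sum_convPow (a : ℕ → ℂ) {N : ℕ} (ha : ∀ n, N < n → a n = 0) (s : ℂ) (k : ℕ) :
    (∑ n ∈ Icc 1 N, a n * ψ (n : ZMod p) * (n : ℂ) ^ (-s)) ^ k =
      ∑ n ∈ Icc 1 (N ^ k), convPow a k n * ψ (n : ZMod p) * (n : ℂ) ^ (-s) := by
  induction k with
  | zero =>
    rw [pow_zero, pow_zero, Finset.Icc_self, Finset.sum_singleton]
    simp [convPow]
  | succ k ih =>
    rw [pow_succ', ih, pow_succ',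
      sum_mul_sum_eq_sum_convolution ψ a (convPow a k) ha (convPow_eq_zero_of_lt a ha k) s]
    rfl

/-! ### The analytic core: `|Σ_{n≤D⁴} a(n)ψ(n)n^{−s}| ≤ 𝓛^{1577/20}` on `Ω₁` from an (3.4)-type bound -/

/-- **Lemma 4.1 for one polynomial, from tree theorems** (the manuscript's proof, p. 17): let
`𝓛 = log D ≥ 32`, `s ∈ Ω₁`, `a : ℕ → ℂ` any coefficients, `a₂₀ = (a·1_{n≤D⁴})^{∗20}` and
`X(y) = Σ_{n≤y} a₂₀(n)ψ(n)n^{−s₀}` (so `X = X₁(·,ψ)` for `a = ν` and `X = X₂(·,ψ)` for `a = υ`).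
If `|X(D⁸⁰)| + ∫₁^{D⁸⁰} |X(y)| dy/y ≤ 𝓛¹¹⁷¹`, then `|Σ_{n≤D⁴} a(n)ψ(n)n^{−s}| ≤ 𝓛^{1577/20}`:
indeed `(Σ_{n≤D⁴} …)²⁰ = Σ_{n≤D⁸⁰} a₂₀(n)ψ(n)n^{−s₀}·n^{s₀−s}` (`sum_pow_eq_sum_convPow`), whose modulus is
`≤ 𝓛^{4/5}|X(D⁸⁰)| + 𝓛⁴⁰⁶∫₁^{D⁸⁰}|X|dy/y` (`Lemma41.norm_F20_le`) `≤ 𝓛⁴⁰⁶·𝓛¹¹⁷¹ = 𝓛¹⁵⁷⁷`.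
[cite: Zhang2022LandauSiegel, §4 Lemma 4.1 (proof)] -/
theorem norm_sum_le_rpow {D : ℕ} (hL : 32 ≤ ell D) {p : ℕ} (ψ : DirichletCharacter ℂ p)
    (a : ℕ → ℂ) {s : ℂ} (hs : s ∈ Omega1 D) (X : ℝ → ℂ)
    (hX : ∀ y : ℝ, X y = ∑ n ∈ Icc 1 ⌊y⌋₊,
      convPow (trunc (D ^ 4) a) 20 n * ψ (n : ZMod p) * (n : ℂ) ^ (-s0 D))
    (hE : ‖X ((D : ℝ) ^ 80)‖ + ∫ y in (1 : ℝ)..(D : ℝ) ^ 80, ‖X y‖ / y ≤ ell D ^ 1171) :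
    ‖∑ n ∈ Icc 1 (D ^ 4), a n * ψ (n : ZMod p) * (n : ℂ) ^ (-s)‖ ≤ ell D ^ ((1577 : ℝ) / 20) := by
  set L : ℝ := ell D with hLdef
  have hL1 : 1 ≤ L := by linarith
  have hL0 : 0 < L := by linarith
  -- `𝓛 = log D ≥ 32` forces `D > 1`
  have hD1 : (1 : ℝ) < D := by
    by_contra h
    push Not at h
    have h' : Real.log (D : ℝ) ≤ 0 := Real.log_nonpos (Nat.cast_nonneg D) h
    have : L = Real.log (D : ℝ) := by rw [hLdef, ell]
    linarith
  have hD0 : (0 : ℝ) < D := by linarith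
  -- the upper endpoint `b = D⁸⁰ = e^{80𝓛}`
  set b : ℝ := (D : ℝ) ^ 80 with hbdef
  have hb1 : 1 ≤ b := one_le_pow₀ hD1.le
  have hbX : b ≤ Real.exp (80 * L) := by
    have h : Real.exp (80 * L) = b := by
      rw [hLdef, ell, show (80 : ℝ) = ((80 : ℕ) : ℝ) by norm_num, Real.exp_nat_mul,
        Real.exp_log hD0]
    rw [h]
  have hbfloor : ⌊b⌋₊ = D ^ 80 := by
    rw [hbdef, ← Nat.cast_pow, Nat.floor_natCast]
  -- `z = s₀ − s` and the three facts about it on `Ω₁`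
  set z : ℂ := s0 D - s with hzdef
  have hzre : z.re = 1 / 2 - s.re := by
    simp [hzdef, s0, SmoothWeight.s0_def]
  have hzim : z.im = 2 * Real.pi * t0 D - s.im := by
    simp [hzdef, s0, SmoothWeight.s0_def]
  have hs' : 1 / 2 - Real.log L / (100 * L) < s.re ∧ s.re < 1 + Real.log L / (100 * L) ∧
      |s.im - 2 * Real.pi * t0 D| < ell1 D + 5 := by
    simpa only [Omega1, Lemma43.mem_Omega1_iff] using hs
  obtain ⟨h1, h2, h3⟩ := hs'
  have hη : Real.log L / (100 * L) ≤ 1 / 100 := by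
    rw [div_le_div_iff₀ (by positivity) (by positivity)]
    nlinarith [Real.log_le_sub_one_of_pos hL0]
  have hz : z.re ≤ Real.log L / (100 * L) := by rw [hzre]; linarith
  have hre : |z.re| ≤ 1 := by
    rw [hzre, abs_le]
    constructor <;> linarith
  have him : |z.im| ≤ L ^ (405 : ℝ) + 5 := by
    rw [hzim, abs_sub_comm, show (405 : ℝ) = ((405 : ℕ) : ℝ) by norm_num, Real.rpow_natCast]
    have : ell1 D = L ^ 405 := by rw [ell1, hLdef]
    linarith
  -- the coefficients `c(n) = a₂₀(n)ψ(n)n^{−s₀}`, `X = Xsum c 0`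
  set c : ℕ → ℂ := fun n => convPow (trunc (D ^ 4) a) 20 n * ψ (n : ZMod p) * (n : ℂ) ^ (-s0 D)
    with hcdef
  have hXs : ∀ y : ℝ, Lemma41.Xsum c 0 y = X y := fun y => by
    rw [Lemma41.Xsum_zero, hX]
  -- Step 1: the sum is the twisted polynomial of the truncated coefficients
  have htr : ∀ n, D ^ 4 < n → trunc (D ^ 4) a n = 0 := fun n hn => by
    simp only [trunc, if_neg (not_le.mpr hn)]
  have hsum : ∑ n ∈ Icc 1 (D ^ 4), a n * ψ (n : ZMod p) * (n : ℂ) ^ (-s) =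
      ∑ n ∈ Icc 1 (D ^ 4), trunc (D ^ 4) a n * ψ (n : ZMod p) * (n : ℂ) ^ (-s) := by
    refine Finset.sum_congr rfl fun n hn => ?_
    simp only [trunc, if_pos (Finset.mem_Icc.mp hn).2]
  -- Step 2: its 20th power, with `n^{−s} = n^{−s₀}·n^{z}`
  have hpow : (∑ n ∈ Icc 1 (D ^ 4), a n * ψ (n : ZMod p) * (n : ℂ) ^ (-s)) ^ 20 =
      ∑ n ∈ Icc 1 ⌊b⌋₊, c n * (n : ℂ) ^ z := by
    rw [hsum, sum_pow_eq_sum_convPow ψ _ htr s 20, ← pow_mul, hbfloor]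
    refine Finset.sum_congr rfl fun n hn => ?_
    have hn0 : (n : ℂ) ≠ 0 := by
      have := (Finset.mem_Icc.mp hn).1
      exact_mod_cast (show n ≠ 0 by omega)
    simp only [hcdef, hzdef]
    rw [mul_assoc (_ * _) ((n : ℂ) ^ (-s0 D)), ← Complex.cpow_add _ _ hn0]
    congr 2
    ring
  -- Step 3: partial integration (tree) and (3.4)
  have key := Lemma41.norm_F20_le c hL hb1 hbX hz hre him
  simp_rw [hXs] at key
  have hX0 : 0 ≤ ‖X b‖ := norm_nonneg _
  have hI0 : 0 ≤ ∫ y in (1 : ℝ)..b, ‖X y‖ / y :=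
    intervalIntegral.integral_nonneg hb1 fun y hy => div_nonneg (norm_nonneg _) (by linarith [hy.1])
  have h45 : L ^ (4 / 5 : ℝ) ≤ L ^ (406 : ℝ) :=
    Real.rpow_le_rpow_of_exponent_le hL1 (by norm_num)
  have h406 : 0 ≤ L ^ (406 : ℝ) := by positivity
  have h20 : ‖∑ n ∈ Icc 1 (D ^ 4), a n * ψ (n : ZMod p) * (n : ℂ) ^ (-s)‖ ^ 20 ≤ L ^ (1577 : ℝ) :=
    calc ‖∑ n ∈ Icc 1 (D ^ 4), a n * ψ (n : ZMod p) * (n : ℂ) ^ (-s)‖ ^ 20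
        = ‖(∑ n ∈ Icc 1 (D ^ 4), a n * ψ (n : ZMod p) * (n : ℂ) ^ (-s)) ^ 20‖ :=
          (norm_pow _ 20).symm
      _ = ‖∑ n ∈ Icc 1 ⌊b⌋₊, c n * (n : ℂ) ^ z‖ := by rw [hpow]
      _ ≤ L ^ (4 / 5 : ℝ) * ‖X b‖ + L ^ (406 : ℝ) * ∫ y in (1 : ℝ)..b, ‖X y‖ / y := key
      _ ≤ L ^ (406 : ℝ) * ‖X b‖ + L ^ (406 : ℝ) * ∫ y in (1 : ℝ)..b, ‖X y‖ / y := by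
          gcongr
      _ = L ^ (406 : ℝ) * (‖X b‖ + ∫ y in (1 : ℝ)..b, ‖X y‖ / y) := by ring
      _ ≤ L ^ (406 : ℝ) * L ^ 1171 := mul_le_mul_of_nonneg_left hE h406
      _ = L ^ (1577 : ℝ) := by
          rw [← Real.rpow_natCast L 1171, ← Real.rpow_add hL0]
          norm_num
  have h := Lemma41.norm_le_rpow_of_pow_le hL0 h20
  exact h

end Lemma41Holds

namespace Skeleton

open Lemma41Holds

/-- **Lemma 4.1 of the manuscript HOLDS as typed** (node `Skeleton.Lemma41`, DAG `Z22:Lem4.1`,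
[Z22 p.16–17, §4 Lemma 4.1, tex L899–L923]): there is `C` (here `C = 2`) such that for all large `D`
(here `D ≥ ⌈e³²⌉`), every real primitive `χ (mod D)`, every `ψ ∈ Ψ₁` and every `s ∈ Ω₁`,
`|F(s,ψ)| + |G(s,ψ)| ≤ C𝓛⁷⁹`. Proof = the manuscript's: `F²⁰ = Σ_{n≤D⁸⁰} ν₂₀ψn^{−s}`
(`Lemma41Holds.sum_pow_eq_sum_convPow`), partial integration on `Ω₁` (`Lemma41.norm_F20_le`), (3.4) from the
definition of `Ψ₁` (`Skeleton.PsiOne`, `Skeleton.Ineq34`), `1577/20 < 79`; likewise for `G`.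
Unconditional (no Assumption (A)); no named fact. [cite: Zhang2022LandauSiegel, §4 Lemma 4.1] -/
theorem lemma41_holds : Lemma41 := by
  refine ⟨2, ⌈Real.exp 32⌉₊, fun D _ χ hD _hq _hp x hx s hs => ?_⟩
  have hexp : Real.exp 32 ≤ D := le_trans (Nat.le_ceil _) (by exact_mod_cast hD)
  have hD0 : (0 : ℝ) < D := lt_of_lt_of_le (Real.exp_pos 32) hexp
  have hL : 32 ≤ ell D := (Real.le_log_iff_exp_le hD0).mpr hexp
  have hL1 : 1 ≤ ell D := by linarith
  have hD1 : (1 : ℝ) ≤ D := by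
    have : (1 : ℝ) ≤ Real.exp 32 := Real.one_le_exp (by norm_num)
    linarith
  obtain ⟨h34, -, -⟩ := hx
  set b : ℝ := (D : ℝ) ^ 80 with hbdef
  have hb1 : 1 ≤ b := one_le_pow₀ hD1
  -- the two step functions `|X₁(y,ψ)|/y`, `|X₂(y,ψ)|/y` are integrable on `[1, D⁸⁰]`
  have hI1 : IntervalIntegrable (fun y : ℝ => ‖X1 χ x y‖ / y) volume 1 b :=
    Lemma36.intervalIntegrable_natFloor_div
      (fun N => ‖∑ n ∈ Icc 1 N, nu20 χ n * x.ψ (n : ZMod x.p) * (n : ℂ) ^ (-s0 D)‖) one_pos hb1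
  have hI2 : IntervalIntegrable (fun y : ℝ => ‖X2 χ x y‖ / y) volume 1 b :=
    Lemma36.intervalIntegrable_natFloor_div
      (fun N => ‖∑ n ∈ Icc 1 N, ups20 χ n * x.ψ (n : ZMod x.p) * (n : ℂ) ^ (-s0 D)‖) one_pos hb1
  have hsplit : ∫ y in (1 : ℝ)..b, (‖X1 χ x y‖ + ‖X2 χ x y‖) / y =
      (∫ y in (1 : ℝ)..b, ‖X1 χ x y‖ / y) + ∫ y in (1 : ℝ)..b, ‖X2 χ x y‖ / y := by
    simp_rw [add_div]
    exact intervalIntegral.integral_add hI1 hI2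
  have hI1n : 0 ≤ ∫ y in (1 : ℝ)..b, ‖X1 χ x y‖ / y :=
    intervalIntegral.integral_nonneg hb1 fun y hy => div_nonneg (norm_nonneg _) (by linarith [hy.1])
  have hI2n : 0 ≤ ∫ y in (1 : ℝ)..b, ‖X2 χ x y‖ / y :=
    intervalIntegral.integral_nonneg hb1 fun y hy => div_nonneg (norm_nonneg _) (by linarith [hy.1])
  have h34' : ‖X1 χ x b‖ + ‖X2 χ x b‖ +
      ((∫ y in (1 : ℝ)..b, ‖X1 χ x y‖ / y) + ∫ y in (1 : ℝ)..b, ‖X2 χ x y‖ / y) < ell D ^ 1171 := by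
    rw [← hsplit]
    exact h34
  have hE1 : ‖X1 χ x b‖ + ∫ y in (1 : ℝ)..b, ‖X1 χ x y‖ / y ≤ ell D ^ 1171 := by
    have := norm_nonneg (X2 χ x b)
    linarith
  have hE2 : ‖X2 χ x b‖ + ∫ y in (1 : ℝ)..b, ‖X2 χ x y‖ / y ≤ ell D ^ 1171 := by
    have := norm_nonneg (X1 χ x b)
    linarith
  have hF : ‖Fpoly χ x s‖ ≤ ell D ^ ((1577 : ℝ) / 20) :=
    norm_sum_le_rpow hL x.ψ (nu χ) hs (X1 χ x) (fun y => rfl) hE1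
  have hG : ‖Gpoly χ x s‖ ≤ ell D ^ ((1577 : ℝ) / 20) :=
    norm_sum_le_rpow hL x.ψ (ups χ) hs (X2 χ x) (fun y => rfl) hE2
  have h79 : ell D ^ ((1577 : ℝ) / 20) ≤ ell D ^ (79 : ℕ) := by
    rw [← Real.rpow_natCast]
    exact Real.rpow_le_rpow_of_exponent_le hL1 (by norm_num)
  linarith

/-- `Lemma41` — `_holds` alias of `lemma41_holds` above under the fact's exact name (appended
2026-08-28, D-0026 bookkeeping: the proof term is the existing theorem of this file; no statement,
definition or attribute is edited; no new named fact; the ledger's debt table listed the fact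
unproved). [cite: Zhang2022LandauSiegel, §4 Lemma 4.1] -/
theorem _root_.Literature.NumberTheory.LFunctions.Zhang2022.Skeleton.Lemma41_holds : Lemma41 :=
  _root_.Literature.NumberTheory.LFunctions.Zhang2022.Skeleton.lemma41_holds

end Skeleton

end Literature.NumberTheory.LFunctions.Zhang2022
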